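import Mathlib
import HarnessLib
import Literature.NumberTheory.Sieve.BatemanHornProofs

/-!
# Route AlmostPrimeZeros — item `ExtractionAtZero` (stmt-Parity-11330): helper lemmas

Helpers for the extraction at the `k`-fold zero
(`Summit.Parity.BatemanHorn.Theses.AlmostPrimeZeros.ExtractionAtZero`, proved in
`AlmostPrimeZerosExtractionAtZero.lean`):

* arithmetic of the capped statistic `s(m) = Σ_{p^v ∥ m} min(v,2)` (written
  `m.factorization.sum fun _ v => min v 2`): `s(p) = 1`, `#primeFactors m ≤ s(m)`, `1 ≤ s(m)` and
  `s(m) ≤ 1 ⇒ m prime` for `m ≥ 2`; for a Bateman–Horn system all `fᵢ(n) ≥ 2` eventually, and then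
  `s_f(n) = Σᵢ s(fᵢ(n)) ≥ k` with equality iff all `fᵢ(n)` are prime (`capped_stat_of_two_le`);
* the two `k`-th derivatives at `0` (Leibniz): `H_x^{(k)}(0) = x⁻¹ e^{kL} Σ_{n ≤ x} T(s_f(n))` with
  `T(m) = [m ≤ k] C(k,m) m! (−kL)^{k−m}` (`iteratedDeriv_normalisedFamily_apply_zero`) and
  `Ψ^{(k)}(0) = k!·Λ(0)·e^{−c}` for `Ψ = Λ e^{(z−1)c} Γ^{−k}` (`iteratedDeriv_limitFunction_apply_zero`);
* counting / splitting / remainder bounds and the abstract limit bookkeeping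
  (`tendsto_mul_of_extraction`).
-/

open Filter Finset Polynomial Topology Complex

namespace Summit.Parity.BatemanHorn.Theorems.AlmostPrimeZerosExtraction


/-- `s(p) = 1` for a prime `p`. -/
theorem factorization_sum_min_two_of_prime {m : ℕ} (hm : m.Prime) :
    (m.factorization.sum fun _ v => min v 2) = 1 := by
  rw [hm.factorization, Finsupp.sum_single_index (by simp)]
  simp

/-- Every prime factor contributes at least `1` to the capped statistic:
`#primeFactors m ≤ s(m)`. -/
theorem card_primeFactors_le_factorization_sum_min_two (m : ℕ) :
    m.primeFactors.card ≤ m.factorization.sum fun _ v => min v 2 := by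
  rw [Finsupp.sum, Nat.support_factorization]
  have h : ∀ p ∈ m.primeFactors, 1 ≤ min (m.factorization p) 2 := by
    intro p hp
    have hp' : m.factorization p ≠ 0 := by
      rw [← Finsupp.mem_support_iff, Nat.support_factorization]
      exact hp
    omega
  simpa using Finset.card_nsmul_le_sum m.primeFactors (fun p => min (m.factorization p) 2) 1 h

/-- `1 ≤ s(m)` for `m ≥ 2`. -/
theorem one_le_factorization_sum_min_two {m : ℕ} (hm : 2 ≤ m) :
    1 ≤ m.factorization.sum fun _ v => min v 2 := by
  have h1 : 1 ≤ m.primeFactors.card :=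
    Finset.card_pos.mpr (Nat.nonempty_primeFactors.mpr (by omega))
  exact h1.trans (card_primeFactors_le_factorization_sum_min_two m)

/-- For `m ≥ 2`, `s(m) ≤ 1` forces `m` to be prime (one prime factor, with exponent `1`). -/
theorem prime_of_factorization_sum_min_two_le_one {m : ℕ} (hm : 2 ≤ m)
    (h : (m.factorization.sum fun _ v => min v 2) ≤ 1) : m.Prime := by
  have hm0 : m ≠ 0 := by omega
  have hcard : m.primeFactors.card ≤ 1 :=
    (card_primeFactors_le_factorization_sum_min_two m).trans h
  have hne : m.primeFactors.Nonempty := Nat.nonempty_primeFactors.mpr (by omega)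
  obtain ⟨p, hp⟩ : ∃ p, m.primeFactors = {p} :=
    Finset.card_eq_one.mp (le_antisymm hcard (Finset.card_pos.mpr hne))
  have hpmem : p ∈ m.primeFactors := by rw [hp]; exact Finset.mem_singleton_self p
  have hpprime : p.Prime := Nat.prime_of_mem_primeFactors hpmem
  have hsupp : m.factorization.support ⊆ {p} := by
    rw [Nat.support_factorization, hp]
  have hsingle : m.factorization = Finsupp.single p (m.factorization p) :=
    Finsupp.support_subset_singleton.mp hsupp
  have hvpos : m.factorization p ≠ 0 := by
    rw [← Finsupp.mem_support_iff, Nat.support_factorization]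
    exact hpmem
  have hsum : (m.factorization.sum fun _ v => min v 2) = min (m.factorization p) 2 := by
    rw [hsingle, Finsupp.sum_single_index (by simp)]
    simp
  have hv1 : m.factorization p = 1 := by
    rw [hsum] at h
    omega
  have hmeq : m = p ^ 1 := Nat.eq_pow_of_factorization_eq_single hm0 (by rw [hsingle, hv1])
  rw [pow_one] at hmeq
  rw [hmeq]
  exact hpprime

/-- In a Bateman–Horn system every `fᵢ(n) ≥ 2` for all sufficiently large `n ∈ ℕ`
(non-constant with positive leading coefficient). -/
theorem exists_forall_two_le_eval {k : ℕ} {f : Fin k → ℤ[X]}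
    (hf : Literature.NumberTheory.Sieve.IsBatemanHornSystem f) :
    ∃ n₀ : ℕ, ∀ n, n₀ ≤ n → ∀ i, (2 : ℤ) ≤ (f i).eval (n : ℤ) := by
  have h : ∀ i, ∀ᶠ n : ℕ in atTop, (2 : ℤ) ≤ (f i).eval (n : ℤ) := by
    intro i
    have hdeg : 0 < ((f i).map (Int.castRingHom ℝ)).degree := by
      rw [Polynomial.degree_map_eq_of_injective Int.cast_injective]
      exact Polynomial.natDegree_pos_iff_degree_pos.mp (hf.natDegree_pos i)
    have hlc : 0 ≤ ((f i).map (Int.castRingHom ℝ)).leadingCoeff := by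
      rw [Polynomial.leadingCoeff_map_of_injective Int.cast_injective, eq_intCast]
      exact_mod_cast (hf.leadingCoeff_pos i).le
    have ht := (Polynomial.tendsto_atTop_of_leadingCoeff_nonneg _ hdeg hlc).comp
      tendsto_natCast_atTop_atTop
    filter_upwards [ht.eventually_ge_atTop (2 : ℝ)] with n hn
    have heq : ((f i).map (Int.castRingHom ℝ)).eval ((n : ℕ) : ℝ) =
        (((f i).eval (n : ℤ) : ℤ) : ℝ) :=
      Polynomial.eval_natCast_map _ _ _
    simp only [Function.comp_apply] at hn
    rw [heq] at hn
    exact_mod_cast hn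
  obtain ⟨n₀, hn₀⟩ := Filter.eventually_atTop.mp (Filter.eventually_all.mpr h)
  exact ⟨n₀, hn₀⟩



/-- Leibniz at `0`: `(d/dz)^k [z^m e^{βz}](0) = C(k,m)·m!·β^{k−m}` if `m ≤ k`, and `0`
otherwise. -/
theorem iteratedDeriv_pow_mul_cexp_apply_zero (β : ℂ) (m k : ℕ) :
    iteratedDeriv k (fun z : ℂ => z ^ m * cexp (β * z)) 0 =
      if m ≤ k then (k.choose m : ℂ) * m.factorial * β ^ (k - m) else 0 := by
  have hf : ContDiffAt ℂ k (fun z : ℂ => z ^ m) 0 := (contDiff_id.pow m).contDiffAt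
  have hg : ContDiffAt ℂ k (fun z : ℂ => cexp (β * z)) 0 :=
    (Complex.contDiff_exp.comp (contDiff_const.mul contDiff_id)).contDiffAt
  rw [iteratedDeriv_fun_mul hf hg]
  simp only [iteratedDeriv_fun_pow_zero, iteratedDeriv_cexp_const_mul, mul_zero, Complex.exp_zero,
    mul_one, Nat.cast_ite, Nat.cast_zero, mul_ite, ite_mul, zero_mul, Finset.sum_ite_eq',
    Finset.mem_range]
  by_cases hmk : m ≤ k
  · rw [if_pos (Nat.lt_succ_of_le hmk), if_pos hmk]
  · rw [if_neg (by omega), if_neg hmk]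

/-- `(d/dz)^k [z^k G(z)](0) = k!·G(0)` for `G` analytic at `0`. -/
theorem iteratedDeriv_pow_mul_of_analyticAt {G : ℂ → ℂ} {k : ℕ} (hG : AnalyticAt ℂ G 0) :
    iteratedDeriv k (fun z : ℂ => z ^ k * G z) 0 = k.factorial * G 0 := by
  have hf : ContDiffAt ℂ k (fun z : ℂ => z ^ k) 0 := (contDiff_id.pow k).contDiffAt
  have hg : ContDiffAt ℂ k G 0 := hG.contDiffAt
  rw [iteratedDeriv_fun_mul hf hg, Finset.sum_eq_single k]
  · rw [iteratedDeriv_fun_pow_zero, if_pos rfl, Nat.choose_self, Nat.sub_self, iteratedDeriv_zero]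
    push_cast
    ring
  · intro i _ hik
    rw [iteratedDeriv_fun_pow_zero, if_neg hik]
    simp
  · intro h
    exact absurd (Finset.mem_range.mpr (Nat.lt_succ_self k)) h

/-- The `k`-th derivative at `0` of the normalised almost-prime family
`H_x(z) = x⁻¹ e^{k(1−z)L} Σ_{n ≤ x} z^{e(n)}`:
`H_x^{(k)}(0) = x⁻¹ e^{kL} Σ_{n ≤ x} T(e n)` with `T(m) = [m ≤ k] C(k,m) m! (−kL)^{k−m}`. -/
theorem iteratedDeriv_normalisedFamily_apply_zero (x k : ℕ) (L : ℂ) (e : ℕ → ℕ) :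
    iteratedDeriv k (fun z : ℂ => (x : ℂ)⁻¹ * cexp ((k : ℂ) * (1 - z) * L) *
        ∑ n ∈ range (x + 1), z ^ (e n)) 0 =
      (x : ℂ)⁻¹ * cexp ((k : ℂ) * L) * ∑ n ∈ range (x + 1),
        (if e n ≤ k then (k.choose (e n) : ℂ) * (e n).factorial * (-((k : ℂ) * L)) ^ (k - e n)
          else 0) := by
  have hfun : (fun z : ℂ => (x : ℂ)⁻¹ * cexp ((k : ℂ) * (1 - z) * L) *
      ∑ n ∈ range (x + 1), z ^ (e n)) =
      fun z => ((x : ℂ)⁻¹ * cexp ((k : ℂ) * L)) *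
        ∑ n ∈ range (x + 1), (z ^ (e n) * cexp (-((k : ℂ) * L) * z)) := by
    funext z
    have hexp : cexp ((k : ℂ) * (1 - z) * L) =
        cexp ((k : ℂ) * L) * cexp (-((k : ℂ) * L) * z) := by
      rw [← Complex.exp_add]
      ring_nf
    rw [hexp, ← Finset.sum_mul]
    ring
  rw [hfun, iteratedDeriv_const_mul_field]
  congr 1
  rw [iteratedDeriv_fun_sum]
  · refine Finset.sum_congr rfl fun n _ => ?_
    exact iteratedDeriv_pow_mul_cexp_apply_zero _ _ _
  · intro n _
    exact ((contDiff_id.pow (e n)).mul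
      (Complex.contDiff_exp.comp (contDiff_const.mul contDiff_id))).contDiffAt

/-- The `k`-th derivative at `0` of the limit `Ψ(z) = Λ(z) e^{(z−1)c} Γ(z)^{−k}`:
`Ψ^{(k)}(0) = k!·Λ(0)·e^{−c}`, because `Γ(z)⁻¹ = z·Γ(z+1)⁻¹` and `Γ(1) = 1`. -/
theorem iteratedDeriv_limitFunction_apply_zero {Λ : ℂ → ℂ}
    (hΛ : DifferentiableOn ℂ Λ (Metric.ball 0 2)) (k : ℕ) (c : ℂ) :
    iteratedDeriv k (fun z : ℂ => Λ z * cexp ((z - 1) * c) * (Complex.Gamma z)⁻¹ ^ k) 0 =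
      k.factorial * (Λ 0 * cexp (-c)) := by
  have hfun : (fun z : ℂ => Λ z * cexp ((z - 1) * c) * (Complex.Gamma z)⁻¹ ^ k) =
      fun z => z ^ k * (Λ z * cexp ((z - 1) * c) * (Complex.Gamma (z + 1))⁻¹ ^ k) := by
    funext z
    rw [Complex.one_div_Gamma_eq_self_mul_one_div_Gamma_add_one z, mul_pow]
    ring
  have h1 : AnalyticAt ℂ Λ 0 := hΛ.analyticAt (Metric.ball_mem_nhds 0 two_pos)
  have h2 : AnalyticAt ℂ (fun z : ℂ => cexp ((z - 1) * c)) 0 :=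
    Differentiable.analyticAt (by fun_prop) 0
  have h3 : AnalyticAt ℂ (fun z : ℂ => (Complex.Gamma (z + 1))⁻¹ ^ k) 0 :=
    ((Complex.differentiable_one_div_Gamma.comp (differentiable_id.add_const 1)).analyticAt 0).pow k
  have hG : AnalyticAt ℂ
      (fun z : ℂ => Λ z * cexp ((z - 1) * c) * (Complex.Gamma (z + 1))⁻¹ ^ k) 0 :=
    (h1.mul h2).mul h3
  rw [hfun, iteratedDeriv_pow_mul_of_analyticAt hG]
  simp [Complex.Gamma_one]



/-- If `P n → Q n` for all `n ≥ n₀`, then `#{n ∈ s : P n} ≤ n₀ + #{n ∈ s : Q n}`. -/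
theorem card_filter_le_add_card_filter {P Q : ℕ → Prop} [DecidablePred P] [DecidablePred Q]
    {n₀ : ℕ} (h : ∀ n, n₀ ≤ n → P n → Q n) (s : Finset ℕ) :
    (s.filter P).card ≤ n₀ + (s.filter Q).card := by
  calc (s.filter P).card ≤ (Finset.range n₀ ∪ s.filter Q).card := by
        refine Finset.card_le_card fun n hn => ?_
        rw [Finset.mem_filter] at hn
        rw [Finset.mem_union, Finset.mem_range, Finset.mem_filter]
        by_cases hlt : n < n₀
        · exact Or.inl hlt
        · exact Or.inr ⟨hn.1, h n (not_lt.mp hlt) hn.2⟩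
    _ ≤ (Finset.range n₀).card + (s.filter Q).card := Finset.card_union_le _ _
    _ = n₀ + (s.filter Q).card := by rw [Finset.card_range]

/-- If `P n` fails for all `n ≥ n₀`, then `#{n ∈ s : P n} ≤ n₀`. -/
theorem card_filter_le_of_forall_not {P : ℕ → Prop} [DecidablePred P] {n₀ : ℕ}
    (h : ∀ n, n₀ ≤ n → ¬P n) (s : Finset ℕ) : (s.filter P).card ≤ n₀ := by
  calc (s.filter P).card ≤ (Finset.range n₀).card := by
        refine Finset.card_le_card fun n hn => ?_
        rw [Finset.mem_filter] at hn
        rw [Finset.mem_range]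
        by_contra hlt
        exact h n (not_lt.mp hlt) hn.2
    _ = n₀ := Finset.card_range n₀

/-- Splitting `Σ_{n ∈ s} T(e n)` (`T(m) = [m ≤ k] C(k,m) m! β^{k−m}`) into the main term
`k!·#{n ∈ s : e n = k}` and the remainder over `e n < k`. -/
theorem sum_extraction_split (k : ℕ) (β : ℂ) (e : ℕ → ℕ) (s : Finset ℕ) :
    ∑ n ∈ s, (if e n ≤ k then (k.choose (e n) : ℂ) * (e n).factorial * β ^ (k - e n) else 0) =
      (k.factorial : ℂ) * (s.filter fun n => e n = k).card +
      ∑ n ∈ s, (if e n < k then (k.choose (e n) : ℂ) * (e n).factorial * β ^ (k - e n) else 0) := by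
  have hpt : ∀ n, (if e n ≤ k then (k.choose (e n) : ℂ) * (e n).factorial * β ^ (k - e n) else 0) =
      (if e n = k then (k.factorial : ℂ) else 0) +
      (if e n < k then (k.choose (e n) : ℂ) * (e n).factorial * β ^ (k - e n) else 0) := by
    intro n
    rcases lt_trichotomy (e n) k with hlt | heq | hgt
    · rw [if_pos hlt.le, if_neg hlt.ne, if_pos hlt, zero_add]
    · rw [if_pos heq.le, if_pos heq, if_neg (lt_irrefl _ ∘ (heq ▸ ·)), heq, Nat.choose_self,
        Nat.sub_self, pow_zero, add_zero]
      push_cast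
      ring
    · rw [if_neg (not_le.mpr hgt), if_neg hgt.ne', if_neg (not_lt.mpr hgt.le), add_zero]
  rw [Finset.sum_congr rfl fun n _ => hpt n, Finset.sum_add_distrib]
  congr 1
  rw [Finset.sum_ite, Finset.sum_const_zero, add_zero, Finset.sum_const, nsmul_eq_mul, mul_comm]

/-- The remainder is supported on `n < n₀` (because `e n ≥ k` for `n ≥ n₀`) and each term is at
most `k!·max(1,‖β‖)^k` in norm. -/
theorem norm_sum_extraction_remainder_le (k : ℕ) (β : ℂ) (e : ℕ → ℕ) (s : Finset ℕ) {n₀ : ℕ}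
    (h : ∀ n, n₀ ≤ n → k ≤ e n) :
    ‖∑ n ∈ s, (if e n < k then (k.choose (e n) : ℂ) * (e n).factorial * β ^ (k - e n) else 0)‖ ≤
      n₀ * (k.factorial * max 1 ‖β‖ ^ k) := by
  have hterm : ∀ n ∈ s,
      ‖(if e n < k then (k.choose (e n) : ℂ) * (e n).factorial * β ^ (k - e n) else 0)‖ ≤
        if e n < k then ((k.factorial : ℝ) * max 1 ‖β‖ ^ k) else 0 := by
    intro n _
    split_ifs with hlt
    · rw [norm_mul, norm_mul, norm_pow, Complex.norm_natCast, Complex.norm_natCast]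
      have h1 : (k.choose (e n) : ℝ) * (e n).factorial ≤ k.factorial := by
        have hkey := Nat.choose_mul_factorial_mul_factorial hlt.le
        have hf : 1 ≤ (k - e n).factorial := Nat.factorial_pos _
        have : k.choose (e n) * (e n).factorial ≤ k.factorial :=
          calc k.choose (e n) * (e n).factorial = k.choose (e n) * (e n).factorial * 1 := by ring
            _ ≤ k.choose (e n) * (e n).factorial * (k - e n).factorial :=
                Nat.mul_le_mul_left _ hf
            _ = k.factorial := hkey
        exact_mod_cast this
      have h2 : ‖β‖ ^ (k - e n) ≤ max 1 ‖β‖ ^ k :=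
        calc ‖β‖ ^ (k - e n) ≤ max 1 ‖β‖ ^ (k - e n) :=
              pow_le_pow_left₀ (norm_nonneg _) (le_max_right _ _) _
          _ ≤ max 1 ‖β‖ ^ k := pow_le_pow_right₀ (le_max_left _ _) (Nat.sub_le _ _)
      exact mul_le_mul h1 h2 (pow_nonneg (norm_nonneg _) _) (Nat.cast_nonneg _)
    · simp
  calc ‖∑ n ∈ s, (if e n < k then (k.choose (e n) : ℂ) * (e n).factorial * β ^ (k - e n) else 0)‖
        ≤ ∑ n ∈ s, ‖(if e n < k then (k.choose (e n) : ℂ) * (e n).factorial * β ^ (k - e n)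
            else 0)‖ := norm_sum_le _ _
    _ ≤ ∑ n ∈ s, (if e n < k then ((k.factorial : ℝ) * max 1 ‖β‖ ^ k) else 0) :=
        Finset.sum_le_sum hterm
    _ = (s.filter fun n => e n < k).card * ((k.factorial : ℝ) * max 1 ‖β‖ ^ k) := by
        rw [Finset.sum_ite, Finset.sum_const_zero, add_zero, Finset.sum_const, nsmul_eq_mul]
    _ ≤ n₀ * ((k.factorial : ℝ) * max 1 ‖β‖ ^ k) := by
        have hc : ((s.filter fun n => e n < k).card : ℝ) ≤ n₀ := by
          exact_mod_cast card_filter_le_of_forall_not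
            (fun n hn hlt => absurd (h n hn) (not_le.mpr hlt)) s
        exact mul_le_mul_of_nonneg_right hc (by positivity)

/-- Abstract limit bookkeeping: from `I(x) → k!·ℓ` (in `ℂ`), `I(x) = a(x)(k!·c(x) + R(x))`
eventually, `a(x)R(x) → 0`, `|c(x) − p(x)| ≤ n₀` and `0 ≤ a(x) → 0`, conclude `a(x)p(x) → ℓ`. -/
theorem tendsto_mul_of_extraction {a : ℕ → ℝ} {c p : ℕ → ℕ} {I R : ℕ → ℂ} {ℓ : ℝ} {k n₀ : ℕ}
    (hT : Tendsto I atTop (𝓝 (((k.factorial : ℝ) * ℓ : ℝ) : ℂ)))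
    (hI : ∀ᶠ x in atTop, I x = (a x : ℂ) * ((k.factorial : ℂ) * (c x : ℂ) + R x))
    (hR : Tendsto (fun x => (a x : ℂ) * R x) atTop (𝓝 0))
    (hcp : ∀ x, (c x : ℝ) ≤ n₀ + p x) (hpc : ∀ x, (p x : ℝ) ≤ n₀ + c x)
    (ha : Tendsto a atTop (𝓝 0)) (ha0 : ∀ x, 0 ≤ a x) :
    Tendsto (fun x => a x * p x) atTop (𝓝 ℓ) := by
  have h1 : Tendsto (fun x => (a x : ℂ) * ((k.factorial : ℂ) * (c x : ℂ))) atTop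
      (𝓝 (((k.factorial : ℝ) * ℓ : ℝ) : ℂ)) := by
    have := hT.sub hR
    rw [sub_zero] at this
    refine this.congr' ?_
    filter_upwards [hI] with x hx
    rw [hx]
    ring
  have hfun : (fun x => (a x : ℂ) * ((k.factorial : ℂ) * (c x : ℂ))) =
      fun x => ((a x * ((k.factorial : ℝ) * (c x : ℝ)) : ℝ) : ℂ) := by
    funext x
    push_cast
    ring
  rw [hfun] at h1
  have h2 := (Complex.continuous_re.tendsto _).comp h1
  simp only [Function.comp_def, Complex.ofReal_re] at h2
  have h3 : Tendsto (fun x => a x * (c x : ℝ)) atTop (𝓝 ℓ) := by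
    have hk : (k.factorial : ℝ) ≠ 0 := by positivity
    have := h2.const_mul ((k.factorial : ℝ)⁻¹)
    rw [inv_mul_cancel_left₀ hk] at this
    refine this.congr fun x => ?_
    field_simp
  refine h3.congr_dist ?_
  refine squeeze_zero (fun x => dist_nonneg) (fun x => ?_) (by simpa using ha.mul_const (n₀ : ℝ))
  rw [Real.dist_eq, ← mul_sub, abs_mul, abs_of_nonneg (ha0 x)]
  refine mul_le_mul_of_nonneg_left ?_ (ha0 x)
  rw [abs_sub_le_iff]
  constructor <;> linarith [hcp x, hpc x]

/-- Elementary facts for `x ≥ 3`: `1 ≤ log x` and `0 ≤ log log x ≤ log x`. -/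
theorem log_facts_of_three_le {x : ℝ} (hx : 3 ≤ x) :
    1 ≤ Real.log x ∧ 0 ≤ Real.log (Real.log x) ∧ Real.log (Real.log x) ≤ Real.log x := by
  have he : Real.exp 1 < 3 := lt_of_lt_of_le Real.exp_one_lt_d9 (by norm_num)
  have h1 : 1 ≤ Real.log x := by
    rw [← Real.log_exp 1]
    exact Real.log_le_log (Real.exp_pos 1) (he.le.trans hx)
  refine ⟨h1, Real.log_nonneg h1, ?_⟩
  have hpos : 0 < Real.log x := by linarith
  linarith [Real.log_le_sub_one_of_pos hpos]


/-- A capped statistic computation at a good argument: if every `fᵢ(n) ≥ 2` then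
`s_f(n) = Σᵢ s(fᵢ(n)) ≥ k`, with equality iff every `fᵢ(n)` is prime. -/
theorem capped_stat_of_two_le {k : ℕ} {f : Fin k → ℤ[X]} {n : ℕ}
    (hn : ∀ i, (2 : ℤ) ≤ (f i).eval (n : ℤ)) :
    k ≤ (∑ i, (((f i).eval (n : ℤ)).toNat.factorization.sum fun _ v => min v 2)) ∧
    ((∑ i, (((f i).eval (n : ℤ)).toNat.factorization.sum fun _ v => min v 2)) = k ↔
      ∀ i, 0 < (f i).eval (n : ℤ) ∧ ((f i).eval (n : ℤ)).toNat.Prime) := by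
  have h2 : ∀ i, 2 ≤ ((f i).eval (n : ℤ)).toNat := fun i => by have := hn i; omega
  have h1 : ∀ i, 1 ≤ (((f i).eval (n : ℤ)).toNat.factorization.sum fun _ v => min v 2) :=
    fun i => one_le_factorization_sum_min_two (h2 i)
  have hk : (∑ _i : Fin k, (1 : ℕ)) = k := by simp
  constructor
  · calc k = ∑ _i : Fin k, (1 : ℕ) := hk.symm
      _ ≤ _ := Finset.sum_le_sum fun i _ => h1 i
  · have key := Finset.sum_eq_sum_iff_of_le (s := Finset.univ) (fun i _ => h1 i)
    rw [hk] at key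
    rw [eq_comm, key]
    refine forall_congr' fun i => ?_
    simp only [Finset.mem_univ, true_implies]
    constructor
    · intro h
      exact ⟨by have := hn i; omega, prime_of_factorization_sum_min_two_le_one (h2 i) h.symm.le⟩
    · rintro ⟨-, hp⟩
      exact (factorization_sum_min_two_of_prime hp).symm

end Summit.Parity.BatemanHorn.Theorems.AlmostPrimeZerosExtraction
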